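import Summits.HubbardSuperconductivity.HubbardSuperconductivity.Theorems.CooperPairDMottWalkCooperPairDMottDWaveResidueStructuralCore

/-!
# Route `CooperPairDMottWalk`, crux `CooperPairDMott` (stmt-HubbardSuperconductivity-1177):
# stub D′b `stub_dWaveResidueStructural` reduced to two structure statements (S1, S3)

Support file for the registered line `Cruxes/CooperPairDMott/Lines/birth.lean`. Stub D′b asserts
`D′a → GCW → D′`: given the plaquette data (unique `(2,0)` plaquette ground state, nonzero `d`-wave
matrix element) and the plaquette grand-canonical window, for every `U ∈ [2,4]`, small `b` and large
`L = 4k+4`, IF the two-hole ground state of the breathing torus `H_L(1,b,U)` is unique THEN some pair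
(`φ₀` parent ground state, `φ₂` two-hole ground state) has `z L² ‖φ₀‖²‖φ₂‖² ≤ |⟨φ₂, Δ_d φ₀⟩|²`, `z > 0`
independent of `L`. `dWaveResidueStructural_of_pairStructure` PROVES `D′a → GCW → S1 → S3 → D′`
(conclusion = the stub verbatim) where, with the block embeddings `f_c` of the `(L/2)²` plaquettes, unit
plaquette ground states `π` (`(2,0)`) and `σ` (`(4,0)`), the local pair-removal operators
`A_c = (f_c)_*|π⟩⟨σ|`, `m = ⟨π, pairField dWaveFormFactor 2 σ⟩`, and ground states `Ω` (parent),
`φ₂` (two holes) of `H_L(1,b,U)`: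

* S1 (STRUCTURE of the two-hole ground state; flat-band engine): `∃ c₁ > 0` such that for all small `b`
  and large `k`, uniqueness of `φ₂` implies `c₁ ‖φ₂‖² Σ_c ‖A_c Ω‖² ≤ |⟨φ₂, Σ_c A_c Ω⟩|²` — `φ₂` overlaps
  the zero-momentum one-plaquette pair removed from the dressed parent, coherently and uniformly in `L`;
* S3 (LOCALITY of the dressed remainder): `∃ C` such that for all small `b`, large `k`,
  `|⟨φ₂, (Δ_d − (m/2) Σ_c A_c) Ω⟩|² ≤ (C b)² L² ‖φ₂‖² ‖Ω‖²` — the part of the `d`-wave pair field with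
  vanishing plaquette `π`–`σ` element (excited intra-plaquette channels, inter-plaquette bonds) has an
  `O(bL)` matrix element between the two ground states (both are EXACTLY zero at `b = 0`).

Constants: `z = |m|² c₁/128`, `b₀ = min(b₁, b₃, γ/128, |m|√(c₁/32)/(2(|C|+1)))`, `k₀ = max`. The proof
is the one-side estimate `dWaveResidue_core` (file `…DWaveResidueStructuralCore`; diagonal Gram bound
`Σ_c ‖A_cΩ‖² ≥ L²‖Ω‖²/8` from GCW) with `π`, `σ` chosen once per `U`, `m ≠ 0` by D′a, the rank-one defect
form by Lieb's theorem on the plaquette, and the existence of sector ground states / block families from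
the tree. Neither S1 nor S3 is proved here (no engine for the `L`-uniform structure of the dressed ground
states is in the tree): they are registered as the residual sub-goals of D′b.

References: D. J. Scalapino, Phys. Rep. 250 (1995) 329, §2 [Scalapino1995]; H. Yao, W.-F. Tsai,
S. A. Kivelson, PRB 76 (2007) 161104 [YaoTsaiKivelson2007]; D. J. Scalapino, S. A. Trugman, Philos.
Mag. B 74 (1996) 607. All statements are [folklore] reductions; no definition is introduced.
-/

set_option linter.dupNamespace false

noncomputable section

namespace Summit.HubbardSuperconductivity.HubbardSuperconductivity.Theorems.CooperPairDMottWalk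

open Matrix Finset Literature.MathematicalPhysics.QuantumLattice Literature.Probability.LatticeModels
open Summit.HubbardSuperconductivity.HubbardSuperconductivity.Theses.CooperPairDMottWalk
open scoped ComplexOrder Matrix.Norms.L2Operator

/-- **Stub D′b (`stub_dWaveResidueStructural`) reduced to the two structure statements.**
GIVEN the plaquette data D′a (unique `(2,0)` plaquette ground state, nonzero `d`-wave matrix element
`m = ⟨π, Δ_d^{plaq} σ⟩`) and the plaquette grand-canonical window GCW (`μ`, `γ > 0`), the structural stub
D′ (ONE good pair of ground states with `z L² ‖φ₀‖²‖φ₂‖² ≤ |⟨φ₂, Δ_d φ₀⟩|²`, given uniqueness of the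
two-hole ground state) follows from two statements about the parent ground state `Ω`, the two-hole
ground state `φ₂` and the local pair-removal operators `A_c = (f_c)_*|π⟩⟨σ|` of the `(L/2)²` plaquettes:
(S1, flat-band structure) `c₁ ‖φ₂‖² Σ_c ‖A_c Ω‖² ≤ |⟨φ₂, Σ_c A_c Ω⟩|²` with `c₁ > 0` uniform in `L`
and small `b` — the two-hole ground state overlaps the zero-momentum one-plaquette pair removed from
the dressed parent coherently; (S3, locality of the dressed remainder)
`|⟨φ₂, (Δ_d − (m/2) Σ_c A_c) Ω⟩| ≤ C b L ‖φ₂‖ ‖Ω‖` — the part of the `d`-wave pair field with no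
plaquette pair-removal amplitude (excited intra-plaquette channels and the inter-plaquette bonds) is
`O(b)` per unit length between the two ground states. Then `z = |m|² c₁ / 128` for
`b < min(γ/128, |m|√(c₁/32)/(2(|C|+1)))`: the diagonal Gram bound
`Σ_c ‖A_cΩ‖² ≥ L²‖Ω‖²/8` (GC-defect averaging through `γ`, `dWaveResidue_core`), D′a for `m ≠ 0`,
Lieb's theorem on the plaquette for the rank-one defect form. No engine for S1, S3 is in the tree.
[cite: Scalapino1995, §2] [cite: YaoTsaiKivelson2007, eq. (2)] -/
theorem dWaveResidueStructural_of_pairStructure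
    (hDa : ∀ U ∈ Set.Icc (2 : ℝ) 4,
      (∀ φ₁ φ₂, IsGroundStateInSector (hubbardTorus 2 2 1 U) 2 0 φ₁ →
        IsGroundStateInSector (hubbardTorus 2 2 1 U) 2 0 φ₂ → ∃ c : ℂ, φ₂ = c • φ₁) ∧
      (∀ φ₂ φ₄, IsGroundStateInSector (hubbardTorus 2 2 1 U) 2 0 φ₂ →
        IsGroundStateInSector (hubbardTorus 2 2 1 U) 4 0 φ₄ →
          star φ₂ ⬝ᵥ (pairField dWaveFormFactor 2 *ᵥ φ₄) ≠ 0))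
    (hGC : ∀ U ∈ Set.Icc (2 : ℝ) 4, ∃ μ γ : ℝ, 0 < γ ∧
      ∀ v : Fock (Orb (FermionTorus 2 2)),
        (∀ w ∈ (szSector 4 0 : Submodule ℂ (Fock (Orb (FermionTorus 2 2)))),
          hubbardTorus 2 2 1 U *ᵥ w = (((hubbardTorus 2 2 1 U).minEnergyOn (szSector 4 0) : ℝ) : ℂ) • w →
            star w ⬝ᵥ v = 0) →
        ((hubbardTorus 2 2 1 U).minEnergyOn (szSector 4 0) - 4 * μ + γ) * (star v ⬝ᵥ v).re ≤
          (star v ⬝ᵥ ((hubbardTorus 2 2 1 U - (μ : ℂ) • totalNumber) *ᵥ v)).re)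
    (hS1 : (let Hb := fun (L : ℕ) (a b U : ℝ) => hamiltonian (fermionTorusGraph 2 L \ (⊤ : SimpleGraph (Fin 2 → ℕ)).comap (fun (x : FermionTorus 2 L) (i : Fin 2) => (ofLex x i : ℕ) / 2)) a U + hamiltonian (fermionTorusGraph 2 L ⊓ (⊤ : SimpleGraph (Fin 2 → ℕ)).comap (fun (x : FermionTorus 2 L) (i : Fin 2) => (ofLex x i : ℕ) / 2)) b 0;
      ∀ U ∈ Set.Icc (2 : ℝ) 4, ∃ c₁ > (0 : ℝ), ∃ b₁ > (0 : ℝ), ∀ b ∈ Set.Ioo 0 b₁, ∃ k₀ : ℕ, ∀ k ≥ k₀,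
        (∀ φ₁ φ₂, IsGroundStateInSector (Hb (4 * k + 4) 1 b U) ((4 * k + 4) ^ 2 - 2) 0 φ₁ →
          IsGroundStateInSector (Hb (4 * k + 4) 1 b U) ((4 * k + 4) ^ 2 - 2) 0 φ₂ → ∃ c : ℂ, φ₂ = c • φ₁) →
        ∀ (f : ℕ × ℕ → (FermionTorus 2 2 ↪o FermionTorus 2 (4 * k + 4))),
          (∀ c ∈ Finset.range ((4 * k + 4) / 2) ×ˢ Finset.range ((4 * k + 4) / 2), ∀ X j,
            (ofLex (f c X) j : ℕ) = ![c.1 * 2, c.2 * 2] j + (ofLex X j : ℕ)) →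
        ∀ (π σ : Fock (Orb (FermionTorus 2 2))), star π ⬝ᵥ π = 1 →
          IsGroundStateInSector (hubbardTorus 2 2 1 U) 2 0 π → star σ ⬝ᵥ σ = 1 →
          IsGroundStateInSector (hubbardTorus 2 2 1 U) 4 0 σ →
        ∀ (Ω φ₂ : Fock (Orb (FermionTorus 2 (4 * k + 4)))),
          IsGroundStateInSector (Hb (4 * k + 4) 1 b U) ((4 * k + 4) ^ 2) 0 Ω →
          IsGroundStateInSector (Hb (4 * k + 4) 1 b U) ((4 * k + 4) ^ 2 - 2) 0 φ₂ →
        c₁ * (star φ₂ ⬝ᵥ φ₂).re *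
            ∑ c ∈ Finset.range ((4 * k + 4) / 2) ×ˢ Finset.range ((4 * k + 4) / 2),
              (star (jwEmbed (orbEmb (f c)) (vecMulVec π (star σ)) *ᵥ Ω) ⬝ᵥ
                (jwEmbed (orbEmb (f c)) (vecMulVec π (star σ)) *ᵥ Ω)).re ≤
          ‖star φ₂ ⬝ᵥ ((∑ c ∈ Finset.range ((4 * k + 4) / 2) ×ˢ Finset.range ((4 * k + 4) / 2),
            jwEmbed (orbEmb (f c)) (vecMulVec π (star σ))) *ᵥ Ω)‖ ^ 2))
    (hS3 : (let Hb := fun (L : ℕ) (a b U : ℝ) => hamiltonian (fermionTorusGraph 2 L \ (⊤ : SimpleGraph (Fin 2 → ℕ)).comap (fun (x : FermionTorus 2 L) (i : Fin 2) => (ofLex x i : ℕ) / 2)) a U + hamiltonian (fermionTorusGraph 2 L ⊓ (⊤ : SimpleGraph (Fin 2 → ℕ)).comap (fun (x : FermionTorus 2 L) (i : Fin 2) => (ofLex x i : ℕ) / 2)) b 0;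
      ∀ U ∈ Set.Icc (2 : ℝ) 4, ∃ C : ℝ, ∃ b₁ > (0 : ℝ), ∀ b ∈ Set.Ioo 0 b₁, ∃ k₀ : ℕ, ∀ k ≥ k₀,
        (∀ φ₁ φ₂, IsGroundStateInSector (Hb (4 * k + 4) 1 b U) ((4 * k + 4) ^ 2 - 2) 0 φ₁ →
          IsGroundStateInSector (Hb (4 * k + 4) 1 b U) ((4 * k + 4) ^ 2 - 2) 0 φ₂ → ∃ c : ℂ, φ₂ = c • φ₁) →
        ∀ (f : ℕ × ℕ → (FermionTorus 2 2 ↪o FermionTorus 2 (4 * k + 4))),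
          (∀ c ∈ Finset.range ((4 * k + 4) / 2) ×ˢ Finset.range ((4 * k + 4) / 2), ∀ X j,
            (ofLex (f c X) j : ℕ) = ![c.1 * 2, c.2 * 2] j + (ofLex X j : ℕ)) →
        ∀ (π σ : Fock (Orb (FermionTorus 2 2))), star π ⬝ᵥ π = 1 →
          IsGroundStateInSector (hubbardTorus 2 2 1 U) 2 0 π → star σ ⬝ᵥ σ = 1 →
          IsGroundStateInSector (hubbardTorus 2 2 1 U) 4 0 σ →
        ∀ (Ω φ₂ : Fock (Orb (FermionTorus 2 (4 * k + 4)))),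
          IsGroundStateInSector (Hb (4 * k + 4) 1 b U) ((4 * k + 4) ^ 2) 0 Ω →
          IsGroundStateInSector (Hb (4 * k + 4) 1 b U) ((4 * k + 4) ^ 2 - 2) 0 φ₂ →
        ‖star φ₂ ⬝ᵥ (pairField dWaveFormFactor (4 * k + 4) *ᵥ Ω) -
            (star π ⬝ᵥ (pairField dWaveFormFactor 2 *ᵥ σ)) / 2 *
              (star φ₂ ⬝ᵥ ((∑ c ∈ Finset.range ((4 * k + 4) / 2) ×ˢ Finset.range ((4 * k + 4) / 2),
                jwEmbed (orbEmb (f c)) (vecMulVec π (star σ))) *ᵥ Ω))‖ ^ 2 ≤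
          (C * b) ^ 2 * ((4 * k + 4 : ℕ) : ℝ) ^ 2 * (star φ₂ ⬝ᵥ φ₂).re * (star Ω ⬝ᵥ Ω).re)) :
    (let Hb := fun (L : ℕ) (a b U : ℝ) => hamiltonian (fermionTorusGraph 2 L \ (⊤ : SimpleGraph (Fin 2 → ℕ)).comap (fun (x : FermionTorus 2 L) (i : Fin 2) => (ofLex x i : ℕ) / 2)) a U + hamiltonian (fermionTorusGraph 2 L ⊓ (⊤ : SimpleGraph (Fin 2 → ℕ)).comap (fun (x : FermionTorus 2 L) (i : Fin 2) => (ofLex x i : ℕ) / 2)) b 0; ∀ U ∈ Set.Icc (2 : ℝ) 4, ∃ b₀ > (0 : ℝ), ∀ b ∈ Set.Ioo 0 b₀, ∃ z > (0 : ℝ), ∃ k₀ : ℕ, ∀ k ≥ k₀, (∀ φ₁ φ₂, IsGroundStateInSector (Hb (4 * k + 4) 1 b U) ((4 * k + 4) ^ 2 - 2) 0 φ₁ → IsGroundStateInSector (Hb (4 * k + 4) 1 b U) ((4 * k + 4) ^ 2 - 2) 0 φ₂ → ∃ c : ℂ, φ₂ = c • φ₁) → ∃ φ₀ φ₂, IsGroundStateInSector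 (Hb (4 * k + 4) 1 b U) ((4 * k + 4) ^ 2) 0 φ₀ ∧ IsGroundStateInSector (Hb (4 * k + 4) 1 b U) ((4 * k + 4) ^ 2 - 2) 0 φ₂ ∧ z * ((4 * k + 4 : ℕ) : ℝ) ^ 2 * (star φ₀ ⬝ᵥ φ₀).re * (star φ₂ ⬝ᵥ φ₂).re ≤ ‖star φ₂ ⬝ᵥ (pairField dWaveFormFactor (4 * k + 4) *ᵥ φ₀)‖ ^ 2) := by
  dsimp only at hS1 hS3 ⊢
  intro U hU
  have hU0 : 0 < U := by linarith [hU.1]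
  obtain ⟨μ, γ, hγ, hgap⟩ := hGC U hU
  obtain ⟨-, hm⟩ := hDa U hU
  -- the plaquette states
  obtain ⟨π, hπ1, hπGS⟩ := exists_unit_isGroundStateInSector_plaquette U (n := 1) (by norm_num)
  obtain ⟨σ, hσ1, hσGS⟩ := exists_unit_isGroundStateInSector_plaquette U (n := 2) le_rfl
  change IsGroundStateInSector (hubbardTorus 2 2 1 U) 2 0 π at hπGS
  change IsGroundStateInSector (hubbardTorus 2 2 1 U) 4 0 σ at hσGS
  set m : ℂ := star π ⬝ᵥ (pairField dWaveFormFactor 2 *ᵥ σ) with hm_def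
  have hm0 : m ≠ 0 := hm π σ hπGS hσGS
  have hmpos : 0 < ‖m‖ := norm_pos_iff.2 hm0
  have hdefect := plaquette_rankOne_defect hU0 hgap hσ1 hσGS
  -- the structure constants
  obtain ⟨c₁, hc₁, b₁, hb₁, hS1b⟩ := hS1 U hU
  obtain ⟨C, b₃, hb₃, hS3b⟩ := hS3 U hU
  have hsq : 0 < Real.sqrt (c₁ / 32) := Real.sqrt_pos.2 (by positivity)
  set a : ℝ := ‖m‖ * Real.sqrt (c₁ / 32) with ha
  have hapos : 0 < a := mul_pos hmpos hsq
  refine ⟨min (min b₁ b₃) (min (γ / 128) (a / (2 * (|C| + 1)))), by positivity, ?_⟩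
  intro b hb
  have hb0 : 0 < b := hb.1
  have hbb₁ : b < b₁ := lt_of_lt_of_le hb.2 ((min_le_left _ _).trans (min_le_left _ _))
  have hbb₃ : b < b₃ := lt_of_lt_of_le hb.2 ((min_le_left _ _).trans (min_le_right _ _))
  have hbγ : b ≤ γ / 128 := (le_of_lt hb.2).trans ((min_le_right _ _).trans (min_le_left _ _))
  have hba : b ≤ a / (2 * (|C| + 1)) := (le_of_lt hb.2).trans ((min_le_right _ _).trans (min_le_right _ _))
  -- `η = |C| b ≤ a / 2`
  have hη : |C| * b ≤ a / 2 := by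
    have h1 : |C| * b ≤ |C| * (a / (2 * (|C| + 1))) := mul_le_mul_of_nonneg_left hba (abs_nonneg C)
    have h2 : |C| * (a / (2 * (|C| + 1))) ≤ a / 2 := by
      rw [mul_div_assoc', div_le_div_iff₀ (by positivity) (by positivity)]
      nlinarith [abs_nonneg C, hapos]
    exact h1.trans h2
  obtain ⟨k₁, hk₁⟩ := hS1b b ⟨hb0, hbb₁⟩
  obtain ⟨k₃, hk₃⟩ := hS3b b ⟨hb0, hbb₃⟩
  refine ⟨(a / 2) ^ 2, by positivity, max k₁ k₃, ?_⟩
  intro k hk huniq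
  have h1 := hk₁ k (le_of_max_le_left hk) huniq
  have h3 := hk₃ k (le_of_max_le_right hk) huniq
  clear hk₁ hk₃ hS1b hS3b
  set L := 4 * k + 4 with hL
  haveI : NeZero L := ⟨by omega⟩
  have hLeven : Even L := ⟨2 * k + 2, by omega⟩
  set p := 8 * (k + 1) ^ 2 with hp
  have hp1 : 1 ≤ p := by
    have : 1 ≤ (k + 1) ^ 2 := Nat.one_le_pow _ _ (by omega)
    omega
  have hLp : L ^ 2 = 2 * p := by rw [hL, hp]; ring
  have hL2 : L ^ 2 - 2 = 2 * (p - 1) := by omega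
  have hcardΛ : Fintype.card (FermionTorus 2 L) = 2 * p := by
    rw [Summit.HubbardSuperconductivity.NoGo.card_fermionTorus_two, hLp]
  -- the block family and the two ground states
  obtain ⟨f, hf⟩ := FermionTorus.exists_blockFamily L 2 (by omega)
  set Gin := fermionTorusGraph 2 L \ (⊤ : SimpleGraph (Fin 2 → ℕ)).comap
    (fun (x : FermionTorus 2 L) (i : Fin 2) => (ofLex x i : ℕ) / 2) with hGin
  set Gout := fermionTorusGraph 2 L ⊓ (⊤ : SimpleGraph (Fin 2 → ℕ)).comap
    (fun (x : FermionTorus 2 L) (i : Fin 2) => (ofLex x i : ℕ) / 2) with hGout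
  obtain ⟨Ω, -, hΩ⟩ := pairTrialCeiling_breathingGroundState Gin Gout 1 b U (n := p) (by rw [hcardΛ]; omega)
  obtain ⟨φ₂, -, hφ₂⟩ := pairTrialCeiling_breathingGroundState Gin Gout 1 b U (n := p - 1)
    (by rw [hcardΛ]; omega)
  have hΩ' : IsGroundStateInSector (hamiltonian Gin 1 U + hamiltonian Gout b 0) (L ^ 2) 0 Ω := by
    rw [hLp]; exact hΩ
  have hφ₂' : IsGroundStateInSector (hamiltonian Gin 1 U + hamiltonian Gout b 0) (L ^ 2 - 2) 0 φ₂ := by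
    rw [hL2]; exact hφ₂
  refine ⟨Ω, φ₂, hΩ', hφ₂', ?_⟩
  -- the two structure hypotheses at this `L`
  have hS1L := h1 f hf π σ hπ1 hπGS hσ1 hσGS Ω φ₂ hΩ' hφ₂'
  have hS3L := h3 f hf π σ hπ1 hπGS hσ1 hσGS Ω φ₂ hΩ' hφ₂'
  have hS3L' : ‖star φ₂ ⬝ᵥ (pairField dWaveFormFactor L *ᵥ Ω) -
      m / 2 * (star φ₂ ⬝ᵥ ((∑ c ∈ Finset.range (L / 2) ×ˢ Finset.range (L / 2),
        jwEmbed (orbEmb (f c)) (vecMulVec π (star σ))) *ᵥ Ω))‖ ^ 2 ≤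
      (|C| * b) ^ 2 * (L : ℝ) ^ 2 * (star φ₂ ⬝ᵥ φ₂).re * (star Ω ⬝ᵥ Ω).re := by
    have : (|C| * b) ^ 2 = (C * b) ^ 2 := by rw [mul_pow, mul_pow, sq_abs]
    rw [this]
    exact hS3L
  have hcore := dWaveResidue_core hLeven U μ γ b hγ hb0 hbγ hσ1 hσGS.1 hσGS.2.2 hdefect hπ1 hf hLp hΩ
    φ₂ m hc₁.le (by positivity) (by linarith) hS1L hS3L'
  -- `(a − |C| b)² ≥ (a/2)²`
  have hmono : (a / 2) ^ 2 ≤ (a - |C| * b) ^ 2 := by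
    have h0 : 0 ≤ a / 2 := by positivity
    have h1 : a / 2 ≤ a - |C| * b := by linarith
    exact pow_le_pow_left₀ h0 h1 2
  have hnn : 0 ≤ (L : ℝ) ^ 2 * (star Ω ⬝ᵥ Ω).re * (star φ₂ ⬝ᵥ φ₂).re := by
    have hΩpos : 0 ≤ (star Ω ⬝ᵥ Ω).re := (Complex.nonneg_iff.1 (dotProduct_star_self_nonneg Ω)).1
    have hφpos : 0 ≤ (star φ₂ ⬝ᵥ φ₂).re := (Complex.nonneg_iff.1 (dotProduct_star_self_nonneg φ₂)).1
    positivity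
  calc (a / 2) ^ 2 * (L : ℝ) ^ 2 * (star Ω ⬝ᵥ Ω).re * (star φ₂ ⬝ᵥ φ₂).re
      = (a / 2) ^ 2 * ((L : ℝ) ^ 2 * (star Ω ⬝ᵥ Ω).re * (star φ₂ ⬝ᵥ φ₂).re) := by ring
    _ ≤ (a - |C| * b) ^ 2 * ((L : ℝ) ^ 2 * (star Ω ⬝ᵥ Ω).re * (star φ₂ ⬝ᵥ φ₂).re) :=
        mul_le_mul_of_nonneg_right hmono hnn
    _ = (‖m‖ * Real.sqrt (c₁ / 32) - |C| * b) ^ 2 * (L : ℝ) ^ 2 * (star Ω ⬝ᵥ Ω).re * (star φ₂ ⬝ᵥ φ₂).re := by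
        rw [ha]; ring
    _ ≤ _ := hcore


/-! ### Registered form -/

/-- **Registered sub-goal `dWaveResidueStructural_conditional`** (closed form, as registered on the crux
item): `D′a → GCW → S1 → S3 → D′` under one `let Hb`. [folklore] -/
theorem dWaveResidueStructural_conditional : (let Hb := fun (L : ℕ) (a b U : ℝ) => hamiltonian (fermionTorusGraph 2 L \ (⊤ : SimpleGraph (Fin 2 → ℕ)).comap (fun (x : FermionTorus 2 L) (i : Fin 2) => (ofLex x i : ℕ) / 2)) a U + hamiltonian (fermionTorusGraph 2 L ⊓ (⊤ : SimpleGraph (Fin 2 → ℕ)).comap (fun (x : FermionTorus 2 L) (i : Fin 2) => (ofLex x i : ℕ) / 2)) b 0; (∀ U ∈ Set.Icc (2 : ℝ) 4, (∀ φ₁ φ₂, IsGroundStateInSector (hubbardTorus 2 2 1 U) 2 0 φ₁ → IsGroundStateInSector (hubbardTorus 2 2 1 U) 2 0 φ₂ → ∃ c : ℂ, φ₂ = c • φ₁) ∧ (∀ φ₂ φ₄, IsGroundStateInSector (hubbardTorus 2 2 1 U) 2 0 φ₂ → IsGroundStateInSector (hubbardTorus 2 2 1 U) 4 0 φ₄ →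 star φ₂ ⬝ᵥ (pairField dWaveFormFactor 2 *ᵥ φ₄) ≠ 0)) → (∀ U ∈ Set.Icc (2 : ℝ) 4, ∃ μ γ : ℝ, 0 < γ ∧ ∀ v : Fock (Orb (FermionTorus 2 2)), (∀ w ∈ szSector (Λ := FermionTorus 2 2) 4 0, hubbardTorus 2 2 1 U *ᵥ w = (((hubbardTorus 2 2 1 U).minEnergyOn (szSector 4 0) : ℝ) : ℂ) • w → star w ⬝ᵥ v = 0) → ((hubbardTorus 2 2 1 U).minEnergyOn (szSector 4 0) - 4 * μ + γ) * (star v ⬝ᵥ v).re ≤ (star v ⬝ᵥ ((hubbardTorus 2 2 1 U - (μ : ℂ) • totalNumber) *ᵥ v)).re) → (∀ U ∈ Set.Icc (2 : ℝ) 4, ∃ c₁ > (0 : ℝ), ∃ b₁ > (0 : ℝ), ∀ b ∈ Set.Ioo 0 b₁, ∃ k₀, ∀ k ≥ k₀, (∀ φ₁ φ₂, IsGroundStateInSector (Hb (4 * k + 4) 1 b U) ((4 * k + 4) ^ 2 - 2) 0 φ₁ → IsGroundStateInSector (Hb (4 * k + 4) 1 b U) ((4 * k + 4) ^ 2 - 2)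 0 φ₂ → ∃ c : ℂ, φ₂ = c • φ₁) → ∀ (f : ℕ × ℕ → FermionTorus 2 2 ↪o FermionTorus 2 (4 * k + 4)), (∀ c ∈ range ((4 * k + 4) / 2) ×ˢ range ((4 * k + 4) / 2), ∀ X j, (ofLex (f c X) j : ℕ) = ![c.1 * 2, c.2 * 2] j + (ofLex X j : ℕ)) → ∀ (π σ : Fock (Orb (FermionTorus 2 2))), star π ⬝ᵥ π = 1 → IsGroundStateInSector (hubbardTorus 2 2 1 U) 2 0 π → star σ ⬝ᵥ σ = 1 → IsGroundStateInSector (hubbardTorus 2 2 1 U) 4 0 σ → ∀ Ω φ₂, IsGroundStateInSector (Hb (4 * k + 4) 1 b U) ((4 * k + 4) ^ 2) 0 Ω → IsGroundStateInSector (Hb (4 * k + 4) 1 b U) ((4 * k + 4) ^ 2 - 2) 0 φ₂ → c₁ * (star φ₂ ⬝ᵥ φ₂).re * ∑ c ∈ range ((4 * k + 4) / 2) ×ˢ range ((4 * k + 4) / 2), (star (jwEmbed (orbEmb (f c)) (vecMulVec π (star σ)) *ᵥ Ω) ⬝ᵥ (jwEmbed (orbEmb (f c)) (vecMulVec π (star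 σ)) *ᵥ Ω)).re ≤ ‖star φ₂ ⬝ᵥ ((∑ c ∈ range ((4 * k + 4) / 2) ×ˢ range ((4 * k + 4) / 2), jwEmbed (orbEmb (f c)) (vecMulVec π (star σ))) *ᵥ Ω)‖ ^ 2) → (∀ U ∈ Set.Icc (2 : ℝ) 4, ∃ C : ℝ, ∃ b₁ > (0 : ℝ), ∀ b ∈ Set.Ioo 0 b₁, ∃ k₀, ∀ k ≥ k₀, (∀ φ₁ φ₂, IsGroundStateInSector (Hb (4 * k + 4) 1 b U) ((4 * k + 4) ^ 2 - 2) 0 φ₁ → IsGroundStateInSector (Hb (4 * k + 4) 1 b U) ((4 * k + 4) ^ 2 - 2) 0 φ₂ → ∃ c : ℂ, φ₂ = c • φ₁) → ∀ (f : ℕ × ℕ → FermionTorus 2 2 ↪o FermionTorus 2 (4 * k + 4)), (∀ c ∈ range ((4 * k + 4) / 2) ×ˢ range ((4 * k + 4) / 2), ∀ X j, (ofLex (f c X) j : ℕ) = ![c.1 * 2, c.2 * 2] j + (ofLex X j : ℕ)) → ∀ (π σ : Fock (Orb (FermionTorus 2 2))), star π ⬝ᵥ π = 1 → IsGroundStateInSector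 (hubbardTorus 2 2 1 U) 2 0 π → star σ ⬝ᵥ σ = 1 → IsGroundStateInSector (hubbardTorus 2 2 1 U) 4 0 σ → ∀ Ω φ₂, IsGroundStateInSector (Hb (4 * k + 4) 1 b U) ((4 * k + 4) ^ 2) 0 Ω → IsGroundStateInSector (Hb (4 * k + 4) 1 b U) ((4 * k + 4) ^ 2 - 2) 0 φ₂ → ‖star φ₂ ⬝ᵥ (pairField dWaveFormFactor (4 * k + 4) *ᵥ Ω) - (star π ⬝ᵥ (pairField dWaveFormFactor 2 *ᵥ σ)) / 2 * (star φ₂ ⬝ᵥ ((∑ c ∈ range ((4 * k + 4) / 2) ×ˢ range ((4 * k + 4) / 2), jwEmbed (orbEmb (f c)) (vecMulVec π (star σ))) *ᵥ Ω))‖ ^ 2 ≤ (C * b) ^ 2 * ((4 * k + 4 : ℕ) : ℝ) ^ 2 * (star φ₂ ⬝ᵥ φ₂).re * (star Ω ⬝ᵥ Ω).re) → ∀ U ∈ Set.Icc (2 : ℝ) 4, ∃ b₀ > (0 : ℝ), ∀ b ∈ Set.Ioo 0 b₀, ∃ z > (0 : ℝ), ∃ k₀ : ℕ, ∀ k ≥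 k₀, (∀ φ₁ φ₂, IsGroundStateInSector (Hb (4 * k + 4) 1 b U) ((4 * k + 4) ^ 2 - 2) 0 φ₁ → IsGroundStateInSector (Hb (4 * k + 4) 1 b U) ((4 * k + 4) ^ 2 - 2) 0 φ₂ → ∃ c : ℂ, φ₂ = c • φ₁) → ∃ φ₀ φ₂, IsGroundStateInSector (Hb (4 * k + 4) 1 b U) ((4 * k + 4) ^ 2) 0 φ₀ ∧ IsGroundStateInSector (Hb (4 * k + 4) 1 b U) ((4 * k + 4) ^ 2 - 2) 0 φ₂ ∧ z * ((4 * k + 4 : ℕ) : ℝ) ^ 2 * (star φ₀ ⬝ᵥ φ₀).re * (star φ₂ ⬝ᵥ φ₂).re ≤ ‖star φ₂ ⬝ᵥ (pairField dWaveFormFactor (4 * k + 4) *ᵥ φ₀)‖ ^ 2) := by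
  intro Hb hDa hGC hS1 hS3
  have h := dWaveResidueStructural_of_pairStructure hDa hGC hS1 hS3
  dsimp only at h
  exact h

end Summit.HubbardSuperconductivity.HubbardSuperconductivity.Theorems.CooperPairDMottWalk

end
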